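import Literature.Analysis.FluidPDE.TorusHeatForcedIcc
import Literature.Analysis.FluidPDE.Antidivergence
import HarnessLib

/-!
# The heat-flow antidivergence of the Cheskidov–Luo local corrector: construction and identification

Analysis/FluidPDE proof file (all results proved), the core of the discharge of the named fact
`Torus.CheskidovLuo2022AntidivergenceBound` (`NavierStokesConcentrationCorrectorFacts`;
A. Cheskidov, X. Luo, *Sharp nonuniqueness for the Navier–Stokes equations*, Invent. Math. 229
(2022) = arXiv:2009.06596, Prop. 3.2, second estimate). Given a divergence-free drift `u`, a
symmetric stress `R` and a smooth solution `(v, q)` on `[a, b] × 𝕋^d` of the linearised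
stress-forced system (3.2), `∂ₜv + (v·∇)v + (u·∇)v + (v·∇)u + ∇q = Δv - div R`, `div v = 0`,
`v(a) = 0`, we

* rewrite the momentum equation in divergence form, componentwise:
  `∂ₜvₗ = Δvₗ - ∑ⱼ ∂ⱼ S̊ₗⱼ - ∂ₗ(q + tr S/d)` with the symmetric tensor
  `S = R + v ⊗ v + v ⊗ u + u ⊗ v` (`Sₗⱼ = Rₗⱼ + vₗvⱼ + vₗuⱼ + uₗvⱼ`) and its traceless part
  `S̊ = S - (tr S/d) I` (`Torus.momentum_divergence_form`; `div (f ⊗ g) = (g·∇)f` for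
  divergence-free `g`);
* solve the forced heat equations `∂ₜAₗⱼ = ΔAₗⱼ - S̊ₗⱼ`, `Aₗⱼ(a) = 0`, and
  `∂ₜπ = Δπ - (q + tr S/d)`, `π(a) = 0` (`Torus.exists_heatForced_Icc`), getting a symmetric,
  trace-free, jointly smooth tensor `A` (uniqueness of heat solutions) and a smooth `π`;
* identify `v = div A + ∇π` on `[a, b]`: for each component `l` and frequency `k` the Fourier
  coefficient `y(t) = 𝓕(vₗ - (div A)ₗ - ∂ₗπ)(t)(k) = v̂ₗ - ∑ⱼ 2πikⱼ Âₗⱼ - 2πikₗ π̂` solves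
  `y' = -4π²|k|² y`, `y(a) = 0` (the three coefficient ODEs, `∂ⱼ ↦ 2πikⱼ`, `Δ ↦ -4π²|k|²`;
  Grafakos 2014, Prop. 3.2.6 (8)), hence vanishes, and continuous functions with vanishing
  coefficients vanish (Prop. 3.2.4);
* record the pointwise bound `|S̊ₗⱼ| ≤ 2(‖R‖ + δ² + 2Mδ)` under `‖v‖ ≤ δ`, `‖u‖ ≤ M`, which feeds
  the `L^r` energy estimate of the heat flow (`TorusHeatLrEstimate`) in the final assembly
  (`NavierStokesCorrectorAntidivergenceBound`).

Main statement: `Torus.exists_heatFlow_antidivergence`.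

## References

* A. Cheskidov, X. Luo, arXiv:2009.06596, Prop. 3.2 and its proof (p. 14–15). [`CheskidovLuo2022`]
* L. Grafakos, *Classical Fourier Analysis*, 3rd ed. (2014), Prop. 3.2.4, Prop. 3.2.6 (8).
  [`Grafakos2014`]
-/

open MeasureTheory Set Filter Topology
open scoped ENNReal ContDiff InnerProductSpace

noncomputable section

namespace Literature.Analysis.FluidPDE

namespace Torus

open UnitAddTorus (mFourierCoeff mFourier)
open Literature.Analysis.FunctionSpaces.Torus (proj stLift timeDerivWithin IsSmoothSpaceTimeOn
  IsSmooth IsContDiff laplacian partialDeriv freqNormSq convect divergence IsDivFree HasZeroMean)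

variable {d : Type*} [Fintype d] [DecidableEq d]

/-! ## Components of the torus operators -/

section Components

omit [Fintype d] [DecidableEq d] in
/-- Coordinates of finite sums of Euclidean vectors. [folklore] -/
theorem euclidean_sum_apply {ι : Type*} (s : Finset ι) (g : ι → EuclideanSpace ℝ d) (l : d) :
    (∑ i ∈ s, g i) l = ∑ i ∈ s, g i l := by
  classical
  induction s using Finset.induction_on with
  | empty => simp
  | insert a s ha ih => simp [Finset.sum_insert ha, ih]

/-- `Δ` commutes with coordinates: `Δ(fₗ) = (Δf)ₗ` for smooth vector fields. [folklore] -/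
theorem laplacian_apply_comp {f : UnitAddTorus d → EuclideanSpace ℝ d} (hf : IsSmooth f) (l : d)
    (x : UnitAddTorus d) : laplacian (fun y => f y l) x = laplacian f x l := by
  rw [FunctionSpaces.Torus.laplacian_eq_sum_partialDeriv_partialDeriv (hf.apply l),
    FunctionSpaces.Torus.laplacian_eq_sum_partialDeriv_partialDeriv hf, euclidean_sum_apply]
  refine Finset.sum_congr rfl fun i _ => ?_
  have h1 : partialDeriv i (fun y => f y l) = fun y => partialDeriv i f y l :=
    funext fun y => FunctionSpaces.Torus.partialDeriv_apply_coord (hf.isContDiff (by simp)) i y l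
  rw [h1, FunctionSpaces.Torus.partialDeriv_apply_coord ((hf.partialDeriv i).isContDiff (by simp)) i x l]

omit [DecidableEq d] in
/-- The one-sided time derivative commutes with coordinates for jointly smooth fields. [folklore] -/
theorem timeDerivWithin_apply_comp {S : Set ℝ} {v : ℝ → UnitAddTorus d → EuclideanSpace ℝ d}
    (hv : IsSmoothSpaceTimeOn S v) (hS : UniqueDiffOn ℝ S) {t : ℝ} (ht : t ∈ S) (x : UnitAddTorus d)
    (l : d) : timeDerivWithin S (fun s y => v s y l) t x = timeDerivWithin S v t x l := by
  have h := hv.hasDerivWithinAt_slice ht x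
  have h2 : HasDerivWithinAt (fun s => v s x l) (timeDerivWithin S v t x l) S t :=
    (EuclideanSpace.proj l : EuclideanSpace ℝ d →L[ℝ] ℝ).hasFDerivAt.comp_hasDerivWithinAt t h
  exact h2.derivWithin (hS t ht)

/-- Coordinates of the convective derivative: `((g·∇)f)ₗ = ∑ⱼ gⱼ ∂ⱼ fₗ`. [folklore] -/
theorem convect_apply_eq {g f : UnitAddTorus d → EuclideanSpace ℝ d} (hf : IsSmooth f)
    (x : UnitAddTorus d) (l : d) :
    convect g f x l = ∑ j, g x j * partialDeriv j (fun y => f y l) x := by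
  unfold FunctionSpaces.Torus.convect
  rw [FunctionSpaces.Torus.fderiv_apply_eq_sum_partialDeriv (hf.isContDiff (by simp)),
    euclidean_sum_apply]
  refine Finset.sum_congr rfl fun j _ => ?_
  rw [PiLp.smul_apply, FunctionSpaces.Torus.partialDeriv_apply_coord (hf.isContDiff (by simp)) j x l, smul_eq_mul]

/-- Coordinates of the tensor divergence: `(div T)ₗ = ∑ⱼ ∂ⱼ Tₗⱼ` (`Tₗⱼ = (T · j)ₗ`). [folklore] -/
theorem tensorDivergence_apply_eq {T : UnitAddTorus d → d → EuclideanSpace ℝ d} (hT : IsSmooth T)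
    (x : UnitAddTorus d) (l : d) :
    tensorDivergence T x l = ∑ j, partialDeriv j (fun y => T y j l) x := by
  unfold tensorDivergence
  rw [euclidean_sum_apply]
  refine Finset.sum_congr rfl fun j _ => ?_
  rw [FunctionSpaces.Torus.partialDeriv_apply_coord ((hT.column j).isContDiff (by simp)) j x l]

/-- Building vectors from coordinates: `(∑ₗ cₗ eₗ)ₘ = cₘ`. [folklore] -/
theorem sum_smul_single_apply (c : d → ℝ) (m : d) :
    (∑ l, c l • EuclideanSpace.single l (1 : ℝ)) m = c m := by
  rw [euclidean_sum_apply]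
  simp

end Components

/-! ## Small analytic lemmas -/

section Lemmas

omit [Fintype d] [DecidableEq d] in
/-- **Linear scalar ODE uniqueness**: if `y' = -ν y` within `[a, b]` (`ν ∈ ℝ`) and `y(a) = 0`
then `y = 0` on `[a, b]` (`(e^{νt} y)' = 0`, Mathlib `constant_of_derivWithin_zero`). [folklore] -/
theorem eq_zero_of_hasDerivWithinAt_linear {a b : ℝ} (hab : a < b) {ν : ℝ} {y : ℝ → ℂ}
    (hy : ∀ s ∈ Icc a b, HasDerivWithinAt y (-(ν : ℂ) * y s) (Icc a b) s) (h0 : y a = 0) :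
    ∀ s ∈ Icc a b, y s = 0 := by
  have hU : UniqueDiffOn ℝ (Icc a b) := uniqueDiffOn_Icc hab
  set z : ℝ → ℂ := fun s => Real.exp (ν * s) • y s with hz
  have hz' : ∀ s ∈ Icc a b, HasDerivWithinAt z 0 (Icc a b) s := by
    intro s hs
    have he : HasDerivAt (fun s : ℝ => Real.exp (ν * s)) (Real.exp (ν * s) * ν) s := by
      have h1 : HasDerivAt (fun s : ℝ => ν * s) (ν * 1) s := (hasDerivAt_id s).const_mul ν
      exact h1.exp.congr_deriv (by ring)
    have h := he.hasDerivWithinAt.smul (hy s hs)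
    refine h.congr_deriv ?_
    rw [Complex.real_smul, Complex.real_smul]
    push_cast
    ring
  have hconst := constant_of_derivWithin_zero (f := z)
    (fun s hs => (hz' s hs).differentiableWithinAt)
    (fun s hs => (hz' s (Ico_subset_Icc_self hs)).derivWithin (hU s (Ico_subset_Icc_self hs)))
  intro s hs
  have h := hconst s hs
  simp only [hz, h0, smul_zero] at h
  exact (smul_eq_zero.1 h).resolve_left (Real.exp_pos _).ne'

/-- **Fourier coefficients of `G - ∑ⱼ ∂ⱼHⱼ - ∂ₗP`** for smooth `ℂ`-valued `G`, `Hⱼ`, `P` on `𝕋^d`: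
`𝓕(G) - ∑ⱼ 2πikⱼ 𝓕(Hⱼ) - 2πikₗ 𝓕(P)` (linearity and `∂ⱼ ↦ 2πikⱼ`, Grafakos 2014,
Prop. 3.2.6 (8)). [folklore] -/
theorem mFourierCoeff_sub_sum_partialDeriv_sub {G P : UnitAddTorus d → ℂ} {H : d → UnitAddTorus d → ℂ}
    (hG : IsSmooth G) (hH : ∀ j, IsSmooth (H j)) (hP : IsSmooth P) (l : d) (k : d → ℤ) :
    mFourierCoeff (fun x => G x - (∑ j, partialDeriv j (H j) x) - partialDeriv l P x) k =
      mFourierCoeff G k - (∑ j, (2 * Real.pi * Complex.I * (k j : ℂ)) * mFourierCoeff (H j) k) -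
        (2 * Real.pi * Complex.I * (k l : ℂ)) * mFourierCoeff P k := by
  have hiG : Integrable G volume := hG.continuous.integrable_unitAddTorus
  have hiH : ∀ j, Integrable (partialDeriv j (H j)) volume := fun j =>
    ((hH j).partialDeriv j).continuous.integrable_unitAddTorus
  have hiS : Integrable (fun x => ∑ j, partialDeriv j (H j) x) volume :=
    integrable_finsetSum _ fun j _ => hiH j
  have hiP : Integrable (partialDeriv l P) volume := (hP.partialDeriv l).continuous.integrable_unitAddTorus
  have h1 : (fun x => G x - (∑ j, partialDeriv j (H j) x) - partialDeriv l P x) =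
      (G - fun x => ∑ j, partialDeriv j (H j) x) - partialDeriv l P := by
    funext x; simp
  rw [h1, FunctionSpaces.Torus.mFourierCoeff_sub (hiG.sub hiS) hiP,
    FunctionSpaces.Torus.mFourierCoeff_sub hiG hiS,
    FunctionSpaces.Torus.mFourierCoeff_finset_sum _ (fun j _ => hiH j),
    FunctionSpaces.Torus.mFourierCoeff_partialDeriv hP]
  simp_rw [FunctionSpaces.Torus.mFourierCoeff_partialDeriv (hH _), smul_eq_mul]

omit [DecidableEq d] in
/-- A continuous `ℂ`-valued function on `𝕋^d` all of whose Fourier coefficients vanish is zero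
(Grafakos 2014, Prop. 3.2.4). [folklore] -/
theorem eq_zero_of_forall_mFourierCoeff_eq_zero {f : UnitAddTorus d → ℂ} (hf : Continuous f)
    (h : ∀ k, mFourierCoeff f k = 0) : ∀ x, f x = 0 := by
  have heq := FunctionSpaces.Torus.eq_of_forall_mFourierCoeff_eq hf continuous_const
    (g := fun _ => (0 : ℂ)) fun k => by rw [h k, mFourierCoeff_zero_fun]
  exact fun x => congrFun heq x

/-- Laplacians of finite sums of smooth functions. [folklore] -/
theorem laplacian_finset_sum' {F : Type*} [NormedAddCommGroup F] [NormedSpace ℝ F] {ι : Type*}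
    (s : Finset ι) {f : ι → UnitAddTorus d → F} (hf : ∀ i ∈ s, IsSmooth (f i)) (x : UnitAddTorus d) :
    laplacian (fun y => ∑ i ∈ s, f i y) x = ∑ i ∈ s, laplacian (f i) x := by
  have hs : IsSmooth (fun y => ∑ i ∈ s, f i y) := isSmooth_finset_sum s hf
  rw [FunctionSpaces.Torus.laplacian_eq_sum_partialDeriv_partialDeriv hs]
  have h1 : ∀ m, partialDeriv m (fun y => ∑ i ∈ s, f i y) = fun y => ∑ i ∈ s, partialDeriv m (f i) y :=
    fun m => funext fun y =>
      FunctionSpaces.Torus.partialDeriv_finset_sum s (fun i hi => (hf i hi).isContDiff (by simp)) m y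
  simp_rw [h1]
  rw [Finset.sum_congr rfl fun m _ => FunctionSpaces.Torus.partialDeriv_finset_sum s
    (fun i hi => ((hf i hi).partialDeriv m).isContDiff (by simp)) m x, Finset.sum_comm]
  refine Finset.sum_congr rfl fun i hi => ?_
  rw [FunctionSpaces.Torus.laplacian_eq_sum_partialDeriv_partialDeriv (hf i hi)]

omit [DecidableEq d] in
/-- One-sided time derivatives of finite sums of jointly smooth fields. [folklore] -/
theorem timeDerivWithin_finset_sum {F : Type*} [NormedAddCommGroup F] [NormedSpace ℝ F] {ι : Type*}
    (s : Finset ι) {S : Set ℝ} {w : ι → ℝ → UnitAddTorus d → F}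
    (hw : ∀ i ∈ s, IsSmoothSpaceTimeOn S (w i)) (hS : UniqueDiffOn ℝ S) {t : ℝ} (ht : t ∈ S)
    (x : UnitAddTorus d) :
    timeDerivWithin S (fun τ y => ∑ i ∈ s, w i τ y) t x = ∑ i ∈ s, timeDerivWithin S (w i) t x := by
  have h : HasDerivWithinAt (fun τ => ∑ i ∈ s, w i τ x) (∑ i ∈ s, timeDerivWithin S (w i) t x) S t :=
    HasDerivWithinAt.fun_sum fun i hi => (hw i hi).hasDerivWithinAt_slice ht x
  exact h.derivWithin (hS t ht)

omit [DecidableEq d] in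
/-- The Laplacian of the zero scalar field vanishes. [folklore] -/
theorem laplacian_zero_scalar (x : UnitAddTorus d) :
    laplacian (fun _ : UnitAddTorus d => (0 : ℝ)) x = 0 := by
  unfold FunctionSpaces.Torus.laplacian FunctionSpaces.Torus.liftAt
  simp

end Lemmas

/-! ## The momentum equation in divergence form, componentwise -/

section DivergenceForm

/-- **The linearised momentum equation in divergence form, componentwise.** If
`D + (V·∇)V + (U·∇)V + (V·∇)U + ∇q = ΔV - div R` at a point `x` (`D` the value of `∂ₜv`), with
`U`, `V` smooth and divergence free, `R` a smooth tensor (by columns, `Rₗⱼ = (R · j)ₗ`), then for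
every smooth scalar `τ` and every coordinate `l`,
`Dₗ = ΔVₗ - ∑ⱼ ∂ⱼ(Rₗⱼ + VₗVⱼ + VₗUⱼ + UₗVⱼ - δₗⱼ τ) - ∂ₗ(q + τ)`:
`div (f ⊗ g) = (g·∇)f + (div g) f` with `div U = div V = 0`, and the `τ`-terms cancel
(Cheskidov–Luo 2022, (3.2): the convective and divergence forms of the system agree). [cite: CheskidovLuo2022, §3.1 (3.2)] -/
theorem momentum_divergence_form_apply
    {U V : UnitAddTorus d → EuclideanSpace ℝ d} {R : UnitAddTorus d → d → EuclideanSpace ℝ d}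
    {q τ : UnitAddTorus d → ℝ} (hU : IsSmooth U) (hV : IsSmooth V) (hR : IsSmooth R)
    (hq : IsSmooth q) (hτ : IsSmooth τ) (hUdiv : IsDivFree U) (hVdiv : IsDivFree V)
    {x : UnitAddTorus d} {D : EuclideanSpace ℝ d}
    (hD : D + convect V V x + convect U V x + convect V U x + FunctionSpaces.Torus.gradient q x =
      laplacian V x - tensorDivergence R x) (l : d) :
    D l = laplacian (fun y => V y l) x -
      (∑ j, partialDeriv j (fun y => R y j l + V y l * V y j + V y l * U y j + U y l * V y j -
        (if l = j then τ y else 0)) x) -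
      partialDeriv l (fun y => q y + τ y) x := by
  -- smoothness bookkeeping
  have hVl : ∀ i, IsSmooth (fun y => V y i) := fun i => hV.apply i
  have hUl : ∀ i, IsSmooth (fun y => U y i) := fun i => hU.apply i
  have hRl : ∀ i j, IsSmooth (fun y => R y j i) := fun i j => (hR.column j).apply i
  have h1 : ∀ {f : UnitAddTorus d → ℝ}, IsSmooth f → IsContDiff 1 f := fun hf => hf.isContDiff (by simp)
  have hite : ∀ j, IsSmooth (fun y => if l = j then τ y else 0) := by
    intro j
    by_cases h : l = j
    · simp only [h, if_true]; exact hτ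
    · simp only [h, if_false]; exact FunctionSpaces.Torus.isSmooth_const _
  -- the component of the hypothesis
  have h := congrArg (fun w : EuclideanSpace ℝ d => w l) hD
  simp only [PiLp.add_apply, PiLp.sub_apply] at h
  rw [convect_apply_eq hV, convect_apply_eq hV, convect_apply_eq hU,
    FunctionSpaces.Torus.gradient_apply (h1 hq), tensorDivergence_apply_eq hR,
    ← laplacian_apply_comp hV] at h
  -- the divergence of the symmetric tensor, componentwise
  have hdivV : ∑ j, partialDeriv j (fun y => V y j) x = 0 := hVdiv x
  have hdivU : ∑ j, partialDeriv j (fun y => U y j) x = 0 := hUdiv x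
  have hterm : ∀ j, partialDeriv j (fun y => R y j l + V y l * V y j + V y l * U y j + U y l * V y j -
      (if l = j then τ y else 0)) x =
      partialDeriv j (fun y => R y j l) x +
        (V x l * partialDeriv j (fun y => V y j) x + partialDeriv j (fun y => V y l) x * V x j) +
        (V x l * partialDeriv j (fun y => U y j) x + partialDeriv j (fun y => V y l) x * U x j) +
        (U x l * partialDeriv j (fun y => V y j) x + partialDeriv j (fun y => U y l) x * V x j) -
        (if l = j then partialDeriv l τ x else 0) := by
    intro j
    have hP1 : IsSmooth (fun y => V y l * V y j) := (hVl l).smul' (hVl j)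
    have hP2 : IsSmooth (fun y => V y l * U y j) := (hVl l).smul' (hUl j)
    have hP3 : IsSmooth (fun y => U y l * V y j) := (hUl l).smul' (hVl j)
    have hS1 : IsSmooth (fun y => R y j l + V y l * V y j) := (hRl l j).add hP1
    have hS2 : IsSmooth (fun y => R y j l + V y l * V y j + V y l * U y j) := hS1.add hP2
    have hS3 : IsSmooth (fun y => R y j l + V y l * V y j + V y l * U y j + U y l * V y j) :=
      hS2.add hP3
    rw [partialDeriv_sub_at (h1 hS3) (h1 (hite j)), partialDeriv_add_apply (h1 hS2) (h1 hP3),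
      partialDeriv_add_apply (h1 hS1) (h1 hP2), partialDeriv_add_apply (h1 (hRl l j)) (h1 hP1),
      FunctionSpaces.Torus.partialDeriv_mul (h1 (hVl l)) (h1 (hVl j)),
      FunctionSpaces.Torus.partialDeriv_mul (h1 (hVl l)) (h1 (hUl j)),
      FunctionSpaces.Torus.partialDeriv_mul (h1 (hUl l)) (h1 (hVl j))]
    congr 1
    by_cases hlj : l = j
    · subst hlj; simp
    · simp only [hlj, if_false]; exact partialDeriv_const_apply (0 : ℝ) j x
  have hsum : ∑ j, partialDeriv j (fun y => R y j l + V y l * V y j + V y l * U y j + U y l * V y j -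
      (if l = j then τ y else 0)) x =
      (∑ j, partialDeriv j (fun y => R y j l) x) +
        (∑ j, V x j * partialDeriv j (fun y => V y l) x) +
        (∑ j, U x j * partialDeriv j (fun y => V y l) x) +
        (∑ j, V x j * partialDeriv j (fun y => U y l) x) - partialDeriv l τ x := by
    simp_rw [hterm]
    simp only [Finset.sum_add_distrib, Finset.sum_sub_distrib, Finset.sum_ite_eq, Finset.mem_univ,
      if_true, ← Finset.mul_sum, hdivV, hdivU, mul_zero, zero_add]
    simp_rw [mul_comm (partialDeriv _ (fun y => V y l) x), mul_comm (partialDeriv _ (fun y => U y l) x)]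
  have hqτ : partialDeriv l (fun y => q y + τ y) x = partialDeriv l q x + partialDeriv l τ x :=
    partialDeriv_add_apply (h1 hq) (h1 hτ) l x
  rw [hsum, hqτ]
  linarith [h]

end DivergenceForm

/-! ## The heat-flow antidivergence -/

section Main

omit [DecidableEq d] in
/-- A tensor field (stored by columns) is jointly smooth when its columns are. [folklore] -/
theorem isSmoothSpaceTimeOn_of_columns {S : Set ℝ} {T : ℝ → UnitAddTorus d → d → EuclideanSpace ℝ d}
    (hT : ∀ j, IsSmoothSpaceTimeOn S (fun t x => T t x j)) : IsSmoothSpaceTimeOn S T := by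
  have h : stLift T = fun z j => stLift (fun t x => T t x j) z := by
    funext z j; rfl
  unfold IsSmoothSpaceTimeOn
  rw [h]
  exact contDiffOn_pi.2 fun j => hT j

/-- **The heat-flow antidivergence of a local corrector** (the construction behind the discharge
of `Torus.CheskidovLuo2022AntidivergenceBound`; Cheskidov–Luo 2022, Prop. 3.2, second estimate,
here for `v = div A + ∇π` with a gradient part instead of `z = ℛvᵢ`). Let `a < b`, `u` a
divergence-free drift and `R` a symmetric stress, both jointly smooth on `[a, b] × 𝕋^d`, and
`(v, q)` a smooth solution of the linearised system (3.2) on `[a, b]` with `v(a) = 0`,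
`‖v‖ ≤ δ`, `‖u‖ ≤ M`. With `Sₗⱼ = Rₗⱼ + vₗvⱼ + vₗuⱼ + uₗvⱼ`, `τ = tr S / d` and
`φₗⱼ = -(Sₗⱼ - δₗⱼ τ)`, let `Aₗⱼ` solve `∂ₜAₗⱼ = ΔAₗⱼ + φₗⱼ`, `Aₗⱼ(a) = 0`, and `π₁` solve
`∂ₜπ₁ = Δπ₁ - (q + τ)`, `π₁(a) = 0` (`Torus.exists_heatForced_Icc`). Then `A` is jointly smooth,
symmetric and trace free (uniqueness of heat solutions), `π = π₁ - ∫ π₁` is smooth of zero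
mean, `v = div A + ∇π` on `[a, b]` (Fourier identification: `y = v̂ₗ - ∑ⱼ 2πikⱼÂₗⱼ - 2πikₗπ̂₁`
solves `y' = -4π²|k|²y`, `y(a) = 0`), and `|φₗⱼ| ≤ 2(‖R‖ + δ² + 2Mδ)` pointwise.
[cite: CheskidovLuo2022, Prop. 3.2 (second estimate, proof)] -/
theorem exists_heatFlow_antidivergence {a b : ℝ} (hab : a < b)
    {u : ℝ → UnitAddTorus d → EuclideanSpace ℝ d} {R : ℝ → UnitAddTorus d → d → EuclideanSpace ℝ d}
    {v : ℝ → UnitAddTorus d → EuclideanSpace ℝ d} {q : ℝ → UnitAddTorus d → ℝ} {M δ : ℝ}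
    (hu : IsSmoothSpaceTimeOn (Icc a b) u) (hudiv : ∀ t ∈ Icc a b, IsDivFree (u t))
    (huM : ∀ t ∈ Icc a b, ∀ x, ‖u t x‖ ≤ M)
    (hR : IsSmoothSpaceTimeOn (Icc a b) R)
    (hRsym : ∀ t ∈ Icc a b, ∀ x, ∀ i j : d, R t x i j = R t x j i)
    (hv : IsSmoothSpaceTimeOn (Icc a b) v) (hq : IsSmoothSpaceTimeOn (Icc a b) q)
    (hmom : ∀ t ∈ Icc a b, ∀ x,
      timeDerivWithin (Icc a b) v t x + convect (v t) (v t) x + convect (u t) (v t) x +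
          convect (v t) (u t) x + FunctionSpaces.Torus.gradient (q t) x =
        laplacian (v t) x - tensorDivergence (R t) x)
    (hvdiv : ∀ t ∈ Icc a b, IsDivFree (v t)) (hv0 : ∀ x, v a x = 0)
    (hvδ : ∀ t ∈ Icc a b, ∀ x, ‖v t x‖ ≤ δ) :
    ∃ (A : ℝ → UnitAddTorus d → d → EuclideanSpace ℝ d) (π : ℝ → UnitAddTorus d → ℝ)
      (φ : d → d → ℝ → UnitAddTorus d → ℝ),
      IsSmoothSpaceTimeOn (Icc a b) A ∧ IsSmoothSpaceTimeOn (Icc a b) π ∧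
      (∀ t ∈ Icc a b, HasZeroMean (π t)) ∧
      (∀ t ∈ Icc a b, ∀ x, ∀ i j : d, A t x i j = A t x j i) ∧
      (∀ t ∈ Icc a b, ∀ x, ∑ i, A t x i i = 0) ∧
      (∀ t ∈ Icc a b, ∀ x, v t x = tensorDivergence (A t) x + FunctionSpaces.Torus.gradient (π t) x) ∧
      (∀ l j, IsSmoothSpaceTimeOn (Icc a b) (φ l j)) ∧
      (∀ l j, ∀ t ∈ Icc a b, ∀ x, timeDerivWithin (Icc a b) (fun s y => A s y j l) t x =
        laplacian (fun y => A t y j l) x + φ l j t x) ∧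
      (∀ (l j : d) (x : UnitAddTorus d), A a x j l = 0) ∧
      (∀ l j, ∀ t ∈ Icc a b, ∀ x, |φ l j t x| ≤ 2 * (‖R t x‖ + (δ ^ 2 + 2 * M * δ))) := by
  have hU : UniqueDiffOn ℝ (Icc a b) := uniqueDiffOn_Icc hab
  -- scalar components of the data
  have hvc : ∀ l, IsSmoothSpaceTimeOn (Icc a b) (fun t x => v t x l) := fun l => hv.apply l
  have huc : ∀ l, IsSmoothSpaceTimeOn (Icc a b) (fun t x => u t x l) := fun l => hu.apply l
  have hRc : ∀ l j, IsSmoothSpaceTimeOn (Icc a b) (fun t x => R t x j l) := fun l j =>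
    (hR.column j).apply l
  -- the symmetric tensor `S`, its normalised trace `τ` and the forcings `φₗⱼ = -(Sₗⱼ - δₗⱼ τ)`
  set σS : d → d → ℝ → UnitAddTorus d → ℝ := fun l j t x =>
    R t x j l + v t x l * v t x j + v t x l * u t x j + u t x l * v t x j with hσS_def
  have hσS : ∀ l j, IsSmoothSpaceTimeOn (Icc a b) (σS l j) := fun l j =>
    (((hRc l j).add ((hvc l).mul (hvc j))).add ((hvc l).mul (huc j))).add ((huc l).mul (hvc j))
  set τ : ℝ → UnitAddTorus d → ℝ := fun t x => (Fintype.card d : ℝ)⁻¹ * ∑ i, σS i i t x with hτ_def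
  have hτ : IsSmoothSpaceTimeOn (Icc a b) τ :=
    (FunctionSpaces.Torus.isSmoothSpaceTimeOn_const (FunctionSpaces.Torus.isSmooth_const _) _).mul
      (IsSmoothSpaceTimeOn.sum fun i _ => hσS i i)
  set φ : d → d → ℝ → UnitAddTorus d → ℝ := fun l j t x =>
    -(σS l j t x - if l = j then τ t x else 0) with hφ_def
  have hφ : ∀ l j, IsSmoothSpaceTimeOn (Icc a b) (φ l j) := by
    intro l j
    by_cases h : l = j
    · have hh : φ l j = fun t x => -(σS l j t x - τ t x) := by
        funext t x; simp [hφ_def, h]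
      rw [hh]; exact ((hσS l j).sub hτ).neg
    · have hh : φ l j = fun t x => -(σS l j t x) := by
        funext t x; simp [hφ_def, h]
      rw [hh]; exact (hσS l j).neg
  have hfπ : IsSmoothSpaceTimeOn (Icc a b) (fun t x => -(q t x + τ t x)) := (hq.add hτ).neg
  -- symmetry of the forcings on `[a, b]`
  have hφsym : ∀ l j, ∀ t ∈ Icc a b, ∀ x, φ j l t x = φ l j t x := by
    intro l j t ht x
    by_cases h : l = j
    · subst h; rfl
    · simp only [hφ_def, hσS_def]
      rw [if_neg h, if_neg (Ne.symm h), hRsym t ht x l j]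
      ring
  -- the heat solutions
  have hex : ∀ l j, ∃ θ : ℝ → UnitAddTorus d → ℝ, IsSmoothSpaceTimeOn (Icc a b) θ ∧
      (∀ t ∈ Icc a b, ∀ x, timeDerivWithin (Icc a b) θ t x = laplacian (θ t) x + φ l j t x) ∧
      θ a = fun _ => 0 := fun l j => exists_heatForced_Icc hab (hφ l j)
  choose Ac hAc hAceq hAc0 using hex
  obtain ⟨π₁, hπ₁, hπ₁eq, hπ₁0⟩ := exists_heatForced_Icc hab hfπ
  -- the tensor and the normalised potential
  set A : ℝ → UnitAddTorus d → d → EuclideanSpace ℝ d := fun t x j =>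
    ∑ l, Ac l j t x • EuclideanSpace.single l (1 : ℝ) with hA_def
  have hAe : ∀ t x j l, A t x j l = Ac l j t x := fun t x j l => sum_smul_single_apply _ _
  have hAfun : ∀ l j, (fun t x => A t x j l) = Ac l j := fun l j => by
    funext t x; exact hAe t x j l
  have hAsm : IsSmoothSpaceTimeOn (Icc a b) A :=
    isSmoothSpaceTimeOn_of_columns fun j => IsSmoothSpaceTimeOn.sum fun l _ =>
      (hAc l j).smul (FunctionSpaces.Torus.isSmoothSpaceTimeOn_const
        (FunctionSpaces.Torus.isSmooth_const _) _)
  set π : ℝ → UnitAddTorus d → ℝ := fun t x => π₁ t x - ∫ y, π₁ t y with hπ_def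
  have hπ : IsSmoothSpaceTimeOn (Icc a b) π := hπ₁.sub (hπ₁.integral_slice hab)
  -- symmetry of `A` from uniqueness of heat solutions
  have hAcsym : ∀ l j, ∀ t ∈ Icc a b, Ac l j t = Ac j l t := fun l j =>
    heatForced_unique_Icc hab (hφ l j) (hAc l j) (hAc j l) (hAceq l j)
      (fun t ht x => by rw [hAceq j l t ht x, hφsym l j t ht x]) (by rw [hAc0, hAc0])
  -- the trace of `A` solves the heat equation with zero forcing, hence vanishes
  have htrφ : ∀ t ∈ Icc a b, ∀ x, ∑ i, φ i i t x = 0 := by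
    intro t _ x
    simp only [hφ_def, if_true, Finset.sum_neg_distrib, Finset.sum_sub_distrib, Finset.sum_const,
      Finset.card_univ, nsmul_eq_mul, neg_eq_zero]
    rw [hτ_def]
    rcases eq_or_ne (Fintype.card d : ℝ) 0 with h0 | h0
    · have hd : IsEmpty d := Fintype.card_eq_zero_iff.1 (by exact_mod_cast h0)
      simp [Finset.univ_eq_empty]
    · field_simp
      ring
  have htrace : ∀ t ∈ Icc a b, ∀ x, ∑ i, Ac i i t x = 0 := by
    have hDsm : IsSmoothSpaceTimeOn (Icc a b) (fun t x => ∑ i, Ac i i t x) :=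
      IsSmoothSpaceTimeOn.sum fun i _ => hAc i i
    have hZsm : IsSmoothSpaceTimeOn (Icc a b) (fun (_ : ℝ) (_ : UnitAddTorus d) => (0 : ℝ)) :=
      FunctionSpaces.Torus.isSmoothSpaceTimeOn_const (FunctionSpaces.Torus.isSmooth_const _) _
    have hDeq : ∀ t ∈ Icc a b, ∀ x, timeDerivWithin (Icc a b) (fun t x => ∑ i, Ac i i t x) t x =
        laplacian (fun x => ∑ i, Ac i i t x) x + (fun (_ : ℝ) (_ : UnitAddTorus d) => (0 : ℝ)) t x := by
      intro t ht x
      rw [timeDerivWithin_finset_sum _ (fun i _ => hAc i i) hU ht x,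
        laplacian_finset_sum' _ (fun i _ => (hAc i i).isSmooth_slice ht) x]
      simp_rw [hAceq _ _ t ht x]
      rw [Finset.sum_add_distrib, htrφ t ht x]
    have hZeq : ∀ t ∈ Icc a b, ∀ x,
        timeDerivWithin (Icc a b) (fun (_ : ℝ) (_ : UnitAddTorus d) => (0 : ℝ)) t x =
        laplacian ((fun (_ : ℝ) (_ : UnitAddTorus d) => (0 : ℝ)) t) x +
          (fun (_ : ℝ) (_ : UnitAddTorus d) => (0 : ℝ)) t x := by
      intro t _ x
      rw [timeDerivWithin_zero, laplacian_zero_scalar, add_zero]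
    have h0 : (fun t x => ∑ i, Ac i i t x) a = (fun (_ : ℝ) (_ : UnitAddTorus d) => (0 : ℝ)) a := by
      funext x
      simp [hAc0]
    intro t ht x
    have h := heatForced_unique_Icc hab hZsm hDsm hZsm hDeq hZeq h0 t ht
    exact congrFun h x
  -- the identification `v = div A + ∇π₁`, componentwise, via Fourier coefficients
  have hident : ∀ l, ∀ t ∈ Icc a b, ∀ x,
      v t x l = (∑ j, partialDeriv j (Ac l j t) x) + partialDeriv l (π₁ t) x := by
    intro l t ht x
    -- complexified fields
    set VC : ℝ → UnitAddTorus d → ℂ := fun s y => ((v s y l : ℝ) : ℂ) with hVC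
    set AC : d → ℝ → UnitAddTorus d → ℂ := fun j s y => ((Ac l j s y : ℝ) : ℂ) with hAC
    set PC : ℝ → UnitAddTorus d → ℂ := fun s y => ((π₁ s y : ℝ) : ℂ) with hPC
    set NC : d → ℝ → UnitAddTorus d → ℂ := fun j s y =>
      (((σS l j s y - if l = j then τ s y else 0 : ℝ)) : ℂ) with hNC
    set QC : ℝ → UnitAddTorus d → ℂ := fun s y => ((q s y + τ s y : ℝ) : ℂ) with hQC
    have hVCs : IsSmoothSpaceTimeOn (Icc a b) VC := (hvc l).ofReal
    have hNs : ∀ j, IsSmoothSpaceTimeOn (Icc a b) (fun s y => σS l j s y - if l = j then τ s y else 0) := by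
      intro j
      have hh : (fun s y => σS l j s y - if l = j then τ s y else 0) = fun s y => -φ l j s y := by
        funext s y; simp [hφ_def]
      rw [hh]; exact (hφ l j).neg
    have hNCs : ∀ j, IsSmoothSpaceTimeOn (Icc a b) (NC j) := fun j => (hNs j).ofReal
    have hQCs : IsSmoothSpaceTimeOn (Icc a b) QC := (hq.add hτ).ofReal
    -- the frequency-wise factors
    set c : d → (d → ℤ) → ℂ := fun j k => 2 * Real.pi * Complex.I * (k j : ℂ) with hc
    set ν : (d → ℤ) → ℝ := fun k => 4 * Real.pi ^ 2 * freqNormSq k with hν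
    -- the combined coefficient `y`
    set y : (d → ℤ) → ℝ → ℂ := fun k s =>
      mFourierCoeff (VC s) k - (∑ j, c j k * mFourierCoeff (AC j s) k) - c l k * mFourierCoeff (PC s) k
      with hy
    -- (1) the derivative of the velocity coefficient
    have hV' : ∀ k, ∀ s ∈ Icc a b, HasDerivWithinAt (fun s => mFourierCoeff (VC s) k)
        (-(ν k : ℂ) * mFourierCoeff (VC s) k - (∑ j, c j k * mFourierCoeff (NC j s) k) -
          c l k * mFourierCoeff (QC s) k) (Icc a b) s := by
      intro k s hs
      have h := ScalarFourier.hasDerivWithinAt_mFourierCoeff hVCs (convex_Icc a b) hU hs k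
      -- the divergence form of the momentum equation at time `s`
      have hvs : IsSmooth (v s) := hv.isSmooth_slice hs
      have hder : timeDerivWithin (Icc a b) VC s = fun x =>
          laplacian (VC s) x - (∑ j, partialDeriv j (NC j s) x) - partialDeriv l (QC s) x := by
        funext x
        have h1 : timeDerivWithin (Icc a b) VC s x = ((timeDerivWithin (Icc a b) v s x l : ℝ) : ℂ) := by
          rw [hVC, timeDerivWithin_ofReal (hvc l) hU hs x, timeDerivWithin_apply_comp hv hU hs x l]
        have h2 := momentum_divergence_form_apply (hu.isSmooth_slice hs) hvs (hR.isSmooth_slice hs)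
          (hq.isSmooth_slice hs) (hτ.isSmooth_slice hs) (hudiv s hs) (hvdiv s hs) (hmom s hs x) l
        rw [h1, h2]
        push_cast
        rw [← laplacian_ofReal (hvs.apply l), ← partialDeriv_ofReal ((hq.add hτ).isSmooth_slice hs)]
        congr 2
        refine Finset.sum_congr rfl fun j _ => ?_
        rw [← partialDeriv_ofReal ((hNs j).isSmooth_slice hs)]
      rw [hder, mFourierCoeff_sub_sum_partialDeriv_sub ((hVCs.isSmooth_slice hs).laplacian)
        (fun j => (hNCs j).isSmooth_slice hs) (hQCs.isSmooth_slice hs),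
        ScalarFourier.mFourierCoeff_laplacian (hVCs.isSmooth_slice hs)] at h
      exact h
    -- (2) the derivative of the tensor coefficients
    have hA' : ∀ k j, ∀ s ∈ Icc a b, HasDerivWithinAt (fun s => mFourierCoeff (AC j s) k)
        (-(ν k : ℂ) * mFourierCoeff (AC j s) k - mFourierCoeff (NC j s) k) (Icc a b) s := by
      intro k j s hs
      have h := hasDerivWithinAt_mFourierCoeff_heatForced hab (hφ l j) (hAc l j) (hAceq l j) k hs
      have hneg : (fun y => ((φ l j s y : ℝ) : ℂ)) = -(NC j s) := by
        funext y; simp [hφ_def, hNC]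
      rw [hneg, FunctionSpaces.Torus.mFourierCoeff_neg] at h
      refine h.congr_deriv ?_
      simp only [hAC, hν]
      ring
    -- (3) the derivative of the potential coefficient
    have hP' : ∀ k, ∀ s ∈ Icc a b, HasDerivWithinAt (fun s => mFourierCoeff (PC s) k)
        (-(ν k : ℂ) * mFourierCoeff (PC s) k - mFourierCoeff (QC s) k) (Icc a b) s := by
      intro k s hs
      have h := hasDerivWithinAt_mFourierCoeff_heatForced hab hfπ hπ₁ hπ₁eq k hs
      have hneg : (fun y => ((-(q s y + τ s y) : ℝ) : ℂ)) = -(QC s) := by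
        funext y; simp [hQC]
      rw [hneg, FunctionSpaces.Torus.mFourierCoeff_neg] at h
      refine h.congr_deriv ?_
      simp only [hPC, hν]
      ring
    -- (4) hence `y' = -ν y`
    have hy' : ∀ k, ∀ s ∈ Icc a b, HasDerivWithinAt (y k) (-(ν k : ℂ) * y k s) (Icc a b) s := by
      intro k s hs
      have h := ((hV' k s hs).sub (HasDerivWithinAt.fun_sum (u := Finset.univ)
        fun j _ => (hA' k j s hs).const_mul (c j k))).sub ((hP' k s hs).const_mul (c l k))
      refine h.congr_deriv ?_
      simp only [hy, mul_sub, Finset.mul_sum, Finset.sum_sub_distrib]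
      ring_nf
    -- (5) `y(a) = 0`, hence `y = 0` on `[a, b]`
    have hy0 : ∀ k, y k a = 0 := by
      intro k
      have h1 : VC a = fun _ => (0 : ℂ) := by funext z; simp [hVC, hv0 z]
      have h2 : ∀ j, AC j a = fun _ => (0 : ℂ) := fun j => by funext z; simp [hAC, hAc0]
      have h3 : PC a = fun _ => (0 : ℂ) := by funext z; simp [hPC, hπ₁0]
      simp only [hy, h1, h2, h3, mFourierCoeff_zero_fun, mul_zero, Finset.sum_const_zero, sub_zero]
    have hyz : ∀ k, y k t = 0 := fun k =>
      eq_zero_of_hasDerivWithinAt_linear hab (hy' k) (hy0 k) t ht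
    -- (6) the continuous defect `W = vₗ - ∑ⱼ ∂ⱼAₗⱼ - ∂ₗπ₁` (complexified) has zero coefficients
    set W : UnitAddTorus d → ℂ := fun x => VC t x - (∑ j, partialDeriv j (AC j t) x) - partialDeriv l (PC t) x
      with hW
    have hACs : ∀ j, IsSmooth (AC j t) := fun j => ((hAc l j).isSmooth_slice ht).comp_clm Complex.ofRealCLM
    have hPCs : IsSmooth (PC t) := (hπ₁.isSmooth_slice ht).comp_clm Complex.ofRealCLM
    have hWcoeff : ∀ k, mFourierCoeff W k = 0 := by
      intro k
      rw [hW, mFourierCoeff_sub_sum_partialDeriv_sub (hVCs.isSmooth_slice ht) hACs hPCs]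
      exact hyz k
    have hWcont : Continuous W :=
      ((hVCs.isSmooth_slice ht).continuous.sub (continuous_finsetSum _ fun j _ =>
        ((hACs j).partialDeriv j).continuous)).sub (hPCs.partialDeriv l).continuous
    have hW0 := eq_zero_of_forall_mFourierCoeff_eq_zero hWcont hWcoeff x
    -- (7) back to real parts
    have hreal : ((v t x l : ℝ) : ℂ) = (((∑ j, partialDeriv j (Ac l j t) x) + partialDeriv l (π₁ t) x : ℝ) : ℂ) := by
      have h1 : ∀ j, partialDeriv j (AC j t) x = ((partialDeriv j (Ac l j t) x : ℝ) : ℂ) := fun j =>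
        partialDeriv_ofReal ((hAc l j).isSmooth_slice ht) j x
      have h2 : partialDeriv l (PC t) x = ((partialDeriv l (π₁ t) x : ℝ) : ℂ) :=
        partialDeriv_ofReal (hπ₁.isSmooth_slice ht) l x
      simp only [hW, h1, h2, hVC] at hW0
      push_cast
      linear_combination hW0
    exact_mod_cast hreal
  -- assembling the conclusions
  refine ⟨A, π, φ, hAsm, hπ, ?_, ?_, ?_, ?_, hφ, ?_, ?_, ?_⟩
  · -- zero mean of `π`
    intro t ht
    have hi : Integrable (π₁ t) volume := (hπ₁.isSmooth_slice ht).integrable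
    change ∫ x, (π₁ t x - ∫ y, π₁ t y) = 0
    rw [integral_sub hi (integrable_const _), integral_const]
    simp
  · -- symmetry
    intro t ht x i j
    rw [hAe, hAe, hAcsym j i t ht]
  · -- trace
    intro t ht x
    simp_rw [hAe]
    exact htrace t ht x
  · -- `v = div A + ∇π`
    intro t ht x
    have hAt : IsSmooth (A t) := hAsm.isSmooth_slice ht
    have hπ₁t : IsSmooth (π₁ t) := hπ₁.isSmooth_slice ht
    ext l
    rw [PiLp.add_apply, tensorDivergence_apply_eq hAt,
      FunctionSpaces.Torus.gradient_apply ((hπ.isSmooth_slice ht).isContDiff (by simp)), hident l t ht x]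
    congr 1
    · refine Finset.sum_congr rfl fun j _ => ?_
      congr 1
      funext y
      exact (hAe t y j l).symm
    · change partialDeriv l (π₁ t) x = partialDeriv l (fun y => π₁ t y - ∫ z, π₁ t z) x
      rw [partialDeriv_sub_at (hπ₁t.isContDiff (by simp)) (FunctionSpaces.Torus.isContDiff_const _),
        partialDeriv_const_apply, sub_zero]
  · -- the heat equations of the entries
    intro l j t ht x
    rw [hAfun l j]
    have h2 : (fun y => A t y j l) = Ac l j t := funext fun y => hAe t y j l
    rw [h2]
    exact hAceq l j t ht x
  · -- zero initial data
    intro l j x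
    rw [hAe, hAc0]
  · -- the pointwise bound of the forcings
    intro l j t ht x
    have hB0 : 0 ≤ δ := (norm_nonneg _).trans (hvδ t ht x)
    have hM0 : 0 ≤ M := (norm_nonneg _).trans (huM t ht x)
    have hvl : ∀ i, |v t x i| ≤ δ := fun i => (FunctionSpaces.Torus.abs_apply_le_norm _ _).trans (hvδ t ht x)
    have hul : ∀ i, |u t x i| ≤ M := fun i => (FunctionSpaces.Torus.abs_apply_le_norm _ _).trans (huM t ht x)
    have hRl : ∀ i m, |R t x m i| ≤ ‖R t x‖ := fun i m =>
      (FunctionSpaces.Torus.abs_apply_le_norm _ _).trans (norm_le_pi_norm (R t x) m)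
    set B : ℝ := ‖R t x‖ + (δ ^ 2 + 2 * M * δ) with hB
    have hσB : ∀ i m, |σS i m t x| ≤ B := by
      intro i m
      simp only [hσS_def]
      calc |R t x m i + v t x i * v t x m + v t x i * u t x m + u t x i * v t x m|
          ≤ |R t x m i| + |v t x i * v t x m| + |v t x i * u t x m| + |u t x i * v t x m| := by
            refine (abs_add_le _ _).trans (add_le_add ((abs_add_le _ _).trans (add_le_add (abs_add_le _ _) le_rfl)) le_rfl)
        _ ≤ ‖R t x‖ + δ * δ + δ * M + M * δ := by
            rw [abs_mul, abs_mul, abs_mul]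
            exact add_le_add (add_le_add (add_le_add (hRl i m)
              (mul_le_mul (hvl i) (hvl m) (abs_nonneg _) hB0))
              (mul_le_mul (hvl i) (hul m) (abs_nonneg _) hB0))
              (mul_le_mul (hul i) (hvl m) (abs_nonneg _) hM0)
        _ = B := by rw [hB]; ring
    have hBnn : 0 ≤ B := (abs_nonneg _).trans (hσB l j)
    have hτB : |τ t x| ≤ B := by
      rw [hτ_def]
      dsimp only
      rcases eq_or_ne (Fintype.card d : ℝ) 0 with h0 | h0
      · rw [h0, inv_zero, zero_mul, abs_zero]; exact hBnn
      · have hcard : 0 < (Fintype.card d : ℝ) := lt_of_le_of_ne (Nat.cast_nonneg _) h0.symm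
        rw [abs_mul, abs_inv, abs_of_pos hcard, inv_mul_le_iff₀ hcard]
        calc |∑ i, σS i i t x| ≤ ∑ i, |σS i i t x| := Finset.abs_sum_le_sum_abs _ _
          _ ≤ ∑ _i : d, B := Finset.sum_le_sum fun i _ => hσB i i
          _ = Fintype.card d * B := by simp
    have hite : |(if l = j then τ t x else 0)| ≤ B := by
      split_ifs
      · exact hτB
      · rw [abs_zero]; exact hBnn
    calc |φ l j t x| = |σS l j t x - if l = j then τ t x else 0| := by rw [hφ_def]; dsimp only; rw [abs_neg]
      _ ≤ |σS l j t x| + |(if l = j then τ t x else 0)| := abs_sub _ _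
      _ ≤ B + B := add_le_add (hσB l j) hite
      _ = 2 * (‖R t x‖ + (δ ^ 2 + 2 * M * δ)) := by rw [hB]; ring

end Main

end Torus

end Literature.Analysis.FluidPDE
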